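import Literature.Analysis.FluidPDE.SelfSimilarEulerBernoulliLocalMax
import Literature.Analysis.FluidPDE.SelfSimilarEulerStagnationStretching
import HarnessLib

/-!
# The Bernoulli maximum of a self-similar Euler profile: a nontrivial in-window profile has at
# least two stagnation points

Analysis/FluidPDE proofs file (theorems only), sixth part of the Eulerian treatment of
Constantin–Ignatova–Vicol 2026 (arXiv:2602.17570) §3.4.3–§3.5 on putative `C²` self-similar Euler
profiles `(U, P)` with exponent `0 < γ < ½` (the Chae–Shvydkoy window), centre `c`, far-field
bounds (3.8), transport field `V = γ(y − c) + U` and Bernoulli function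
`ℋ = ½|V|² + P + ½γ(γ−1)|y−c|²`.

* `IsSelfSimilarEulerProfile.fderiv_pressure_apply` — `DP[w] = −(1−γ)⟪U, w⟫ − ⟪DU V, w⟫`
  ((3.3) dotted with `w`);
* `IsSelfSimilarEulerProfile.pressure_le_of_hasSelfSimilarFarFieldWith` — under (3.8) the
  pressure is bounded above, `P(y) ≤ P(c) + C(1+C) γ/(1−2γ)` (integrate
  `|∇P| ≤ C(1+C) s r² ⟨s r⟩^{−1/γ}` along the segment from `c`; the majorant
  `(1 + s²r²)^{1−1/(2γ)}` is decreasing since `1/(2γ) > 1`);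
* `IsSelfSimilarEulerProfile.selfSimilarBernoulli_lt_center_of_far` — hence
  `ℋ(y) ≤ −¼γ(1−2γ)|y−c|² + O(1) < ℋ(c)` far out;
* `IsSelfSimilarEulerProfile.exists_isMaxOn_selfSimilarBernoulli` — so `ℋ` attains its maximum
  on `ℝ³`, at a critical point, i.e. (CIV (3.33)) at a STAGNATION point;
* `IsSelfSimilarEulerProfile.exists_bernoulliTop_stagnation` — **the Bernoulli-top stagnation
  point is non-vortical with `DV ≥ 0`** (stretching rates `⟪DU(z) w, w⟫ ≤ 2γ|w|² < |w|²`), by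
  `SelfSimilarEulerBernoulliLocalMax`;
* `IsSelfSimilarEulerProfile.exists_two_stagnation_points` — **a NONTRIVIAL in-window profile
  with (3.8) has at least two stagnation points**: the Bernoulli-top one (good) and one carrying a
  stretching rate `≥ 1` (`exists_stagnation_stretching_ge_one`), necessarily distinct. In
  particular (CIV's normalisation `𝒩_V ∋ 0`): **a profile whose only stagnation point is the
  centre is trivial** (`eq_zero_of_selfSimilarNodalSet_subsingleton`).

WHAT THIS IS NOT: no claim about profiles with two or more stagnation points beyond the
dichotomy above; all objects are MODEL objects (stationary self-similar Euler profiles), not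
Navier–Stokes solutions.

## References

* P. Constantin, M. Ignatova, V. Vicol, arXiv:2602.17570 (2026), §3.1.3 (3.8), §3.4.3
  (3.29)–(3.33), §3.5. [ConstantinIgnatovaVicol2026Putative]

## Mathlib / tree search

Reused: `HasSelfSimilarFarFieldWith.tendsto_decayFactor`, `.apply_center`, `.nonneg`,
`contDiff_selfSimilarBernoulli`, `fderiv_selfSimilarBernoulli_transport`,
`not_isLocalMax_selfSimilarBernoulli_of_curl_ne_zero`,
`inner_fderiv_le_of_isLocalMax_selfSimilarBernoulli`, `exists_stagnation_stretching_ge_one`.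
Mathlib: `antitoneOn_of_deriv_nonpos`, `HasDerivAt.rpow_const`, `Continuous.exists_forall_ge'`,
`IsLocalMax.fderiv_eq_zero`, `Filter.mem_cocompact`.
-/

noncomputable section

open Set Filter Topology InnerProductSpace Metric
open scoped RealInnerProductSpace

namespace Literature.Analysis.FluidPDE

namespace IsSelfSimilarEulerProfile

variable {γ : ℝ} {c : EuclideanSpace ℝ (Fin 3)}
  {U : EuclideanSpace ℝ (Fin 3) → EuclideanSpace ℝ (Fin 3)} {P : EuclideanSpace ℝ (Fin 3) → ℝ}

/-- The pressure gradient along a vector, from the profile equation (3.3):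
`DP(y)[w] = −(1−γ)⟪U, w⟫ − ⟪DU(y) V(y), w⟫`. [cite: ConstantinIgnatovaVicol2026Putative, §3.1.1 eq. (3.3)] -/
theorem fderiv_pressure_apply (h : IsSelfSimilarEulerProfile γ c U P) (y w : EuclideanSpace ℝ (Fin 3)) :
    fderiv ℝ P y w = -((1 - γ) * ⟪U y, w⟫) - ⟪fderiv ℝ U y (γ • (y - c) + U y), w⟫ := by
  have e2 := congrArg (fun z => ⟪z, w⟫) (h.profile_eq y)
  simp only [inner_add_left, inner_smul_left, inner_zero_left, conj_trivial] at e2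
  rw [inner_gradient_left] at e2
  linarith

/-- **The pressure of an in-window profile with the far-field bounds is bounded above**:
`P(y) ≤ P(c) + C(1+C)γ/(1−2γ)` for all `y` (integrate `|∇P| ≤ C(1+C) s r² ⟨s r⟩^{−1/γ}` along
the segment from `c` to `y`; the majorant `(1 + s²r²)^{1 − 1/(2γ)}` is decreasing).
[cite: ConstantinIgnatovaVicol2026Putative, §3.1.3 eq. (3.8) (consequence for the pressure of (3.3))] -/
theorem pressure_le_of_hasSelfSimilarFarFieldWith (h : IsSelfSimilarEulerProfile γ c U P)
    (hγ : 0 < γ) (hγ2 : γ < 1 / 2) {C : ℝ} (hfar : HasSelfSimilarFarFieldWith γ c C U)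
    (y : EuclideanSpace ℝ (Fin 3)) :
    P y ≤ P c + C * (1 + C) * (γ / (1 - 2 * γ)) := by
  have hγ1 : γ ≤ 1 := by linarith
  have hC0 : 0 ≤ C := hfar.nonneg
  set e : ℝ := 1 / (2 * γ) with hedef
  have he1 : 1 < e := by
    rw [hedef, lt_div_iff₀ (by positivity)]; linarith
  set r : ℝ := ‖y - c‖ with hrdef
  set d : EuclideanSpace ℝ (Fin 3) := y - c with hddef
  have hUd : Differentiable ℝ U := h.differentiable_velocity
  have hPd : Differentiable ℝ P := h.differentiable_pressure
  -- the segment `p s = c + s • d`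
  set p : ℝ → EuclideanSpace ℝ (Fin 3) := fun s => c + s • d with hpdef
  have hp : ∀ s, HasDerivAt p d s := fun s => by
    have := ((hasDerivAt_id s).smul_const d).const_add c
    simpa [hpdef] using this
  have hpc : ∀ s, p s - c = s • d := fun s => by simp [hpdef]
  have hpn : ∀ s, 0 ≤ s → ‖p s - c‖ = s * r := fun s hs => by
    rw [hpc, norm_smul, Real.norm_eq_abs, abs_of_nonneg hs]
  -- `φ = P ∘ p` and its derivative
  set φ : ℝ → ℝ := fun s => P (p s) with hφdef
  have hφ : ∀ s, HasDerivAt φ (fderiv ℝ P (p s) d) s := fun s =>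
    (hPd (p s)).hasFDerivAt.comp_hasDerivAt s (hp s)
  -- the constant `K₁ = C(1+C)` and the bound `|φ'(s)| ≤ K₁ s r² (1 + s² r²)^{-e}` for `s ≥ 0`
  set K₁ : ℝ := C * (1 + C) with hK₁
  have hK₁0 : 0 ≤ K₁ := by positivity
  have hbound : ∀ s, 0 ≤ s → fderiv ℝ P (p s) d ≤ K₁ * s * r ^ 2 * (1 + (s * r) ^ 2) ^ (-e) := by
    intro s hs
    have hsr : 0 ≤ s * r := mul_nonneg hs (norm_nonneg _)
    set δ : ℝ := (1 + (s * r) ^ 2) ^ (-e) with hδ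
    have hδ0 : 0 ≤ δ := Real.rpow_nonneg (by positivity) _
    have hδ1 : δ ≤ 1 := by
      rw [hδ]
      exact Real.rpow_le_one_of_one_le_of_nonpos (by nlinarith) (by linarith)
    have hU := (hfar (p s)).1
    have hDU := (hfar (p s)).2
    rw [hpn s hs] at hU hDU
    have hedef' : -(1 / (2 * γ)) = -e := by rw [hedef]
    rw [hedef'] at hU hDU
    -- `‖U(p s)‖ ≤ C s r δ`, `‖DU(p s)‖ ≤ C δ`, `‖V(p s)‖ ≤ (γ + C) s r`
    have hU' : ‖U (p s)‖ ≤ C * (s * r) * δ := hU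
    have hDU' : ‖fderiv ℝ U (p s)‖ ≤ C * δ := by
      linarith [norm_nonneg (curl U (p s))]
    have hV' : ‖γ • (p s - c) + U (p s)‖ ≤ (γ + C) * (s * r) := by
      calc ‖γ • (p s - c) + U (p s)‖ ≤ ‖γ • (p s - c)‖ + ‖U (p s)‖ := norm_add_le _ _
        _ = γ * (s * r) + ‖U (p s)‖ := by
            rw [norm_smul, Real.norm_eq_abs, abs_of_pos hγ, hpn s hs]
        _ ≤ γ * (s * r) + C * (s * r) * δ := by linarith
        _ ≤ γ * (s * r) + C * (s * r) * 1 := by gcongr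
        _ = (γ + C) * (s * r) := by ring
    rw [h.fderiv_pressure_apply]
    have h1 : -((1 - γ) * ⟪U (p s), d⟫) ≤ (1 - γ) * (C * (s * r) * δ) * r := by
      have := abs_real_inner_le_norm (U (p s)) d
      have := (abs_le.1 this).1
      have h1γ : 0 ≤ 1 - γ := by linarith
      nlinarith [mul_le_mul_of_nonneg_right hU' (norm_nonneg d), norm_nonneg d]
    have h2 : -⟪fderiv ℝ U (p s) (γ • (p s - c) + U (p s)), d⟫ ≤ C * δ * ((γ + C) * (s * r)) * r := by
      have ha := abs_real_inner_le_norm (fderiv ℝ U (p s) (γ • (p s - c) + U (p s))) d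
      have hb := (abs_le.1 ha).1
      have hc : ‖fderiv ℝ U (p s) (γ • (p s - c) + U (p s))‖ ≤ C * δ * ((γ + C) * (s * r)) :=
        (ContinuousLinearMap.le_opNorm _ _).trans
          (mul_le_mul hDU' hV' (norm_nonneg _) (mul_nonneg hC0 hδ0))
      nlinarith [mul_le_mul_of_nonneg_right hc (norm_nonneg d), norm_nonneg d]
    have h3 : (1 - γ) * (C * (s * r) * δ) * r + C * δ * ((γ + C) * (s * r)) * r =
        K₁ * s * r ^ 2 * δ := by rw [hK₁]; ring
    linarith
  -- the decreasing majorant `Ψ(s) = φ(s) + k (1 + s²r²)^{1-e}`, `k = K₁/(2(e-1))`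
  set k : ℝ := K₁ / (2 * (e - 1)) with hkdef
  have hk0 : 0 ≤ k := by rw [hkdef]; apply div_nonneg hK₁0; linarith
  set Ψ : ℝ → ℝ := fun s => φ s + k * (1 + (s * r) ^ 2) ^ (1 - e) with hΨdef
  have hM : ∀ s, HasDerivAt (fun s : ℝ => (1 + (s * r) ^ 2) ^ (1 - e))
      ((2 * s * r ^ 2) * (1 - e) * (1 + (s * r) ^ 2) ^ (1 - e - 1)) s := by
    intro s
    have h1 : HasDerivAt (fun s : ℝ => 1 + (s * r) ^ 2) (2 * s * r ^ 2) s := by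
      have h0 : HasDerivAt (fun x : ℝ => x * r) r s := hasDerivAt_mul_const r
      have h2 := (h0.mul h0).const_add 1
      have hfun : (fun s : ℝ => 1 + (s * r) ^ 2) = fun x => 1 + x * r * (x * r) := by
        funext x; ring
      rw [hfun]
      refine h2.congr_deriv ?_
      ring
    exact h1.rpow_const (Or.inl (by positivity))
  have hΨ : ∀ s, HasDerivAt Ψ (fderiv ℝ P (p s) d +
      k * ((2 * s * r ^ 2) * (1 - e) * (1 + (s * r) ^ 2) ^ (1 - e - 1))) s := fun s =>
    (hφ s).add ((hM s).const_mul k)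
  have hΨ' : ∀ s, 0 ≤ s → deriv Ψ s ≤ 0 := by
    intro s hs
    rw [(hΨ s).deriv]
    have hb := hbound s hs
    have hk2 : k * (2 * (1 - e)) = -K₁ := by
      rw [hkdef, div_mul_eq_mul_div, div_eq_iff (by
        have : 0 < e - 1 := by linarith
        positivity)]
      ring
    have e1 : k * ((2 * s * r ^ 2) * (1 - e) * (1 + (s * r) ^ 2) ^ (1 - e - 1)) =
        -(K₁ * s * r ^ 2 * (1 + (s * r) ^ 2) ^ (-e)) := by
      have : (1 : ℝ) - e - 1 = -e := by ring
      rw [this]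
      have : k * ((2 * s * r ^ 2) * (1 - e) * (1 + (s * r) ^ 2) ^ (-e)) =
          (k * (2 * (1 - e))) * (s * r ^ 2 * (1 + (s * r) ^ 2) ^ (-e)) := by ring
      rw [this, hk2]
      ring
    rw [e1]
    linarith
  have hanti : AntitoneOn Ψ (Icc 0 1) := by
    refine antitoneOn_of_deriv_nonpos (convex_Icc 0 1)
      (fun s _ => (hΨ s).continuousAt.continuousWithinAt)
      (fun s _ => (hΨ s).differentiableAt.differentiableWithinAt) fun s hs => ?_
    rw [interior_Icc] at hs
    exact hΨ' s hs.1.le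
  have h01 := hanti (left_mem_Icc.2 zero_le_one) (right_mem_Icc.2 zero_le_one) zero_le_one
  -- unpack `Ψ 1 ≤ Ψ 0`
  have hΨ0 : Ψ 0 = P c + k := by
    simp [hΨdef, hφdef, hpdef]
  have hΨ1 : Ψ 1 = P y + k * (1 + r ^ 2) ^ (1 - e) := by
    simp [hΨdef, hφdef, hpdef, hddef]
  rw [hΨ0, hΨ1] at h01
  have hpos : 0 ≤ k * (1 + r ^ 2) ^ (1 - e) := mul_nonneg hk0 (Real.rpow_nonneg (by positivity) _)
  have hk : k = C * (1 + C) * (γ / (1 - 2 * γ)) := by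
    have h1 : (1 : ℝ) - 2 * γ ≠ 0 := by linarith
    have h2e : 2 * (e - 1) = (1 - 2 * γ) / γ := by
      rw [hedef, eq_div_iff hγ.ne']
      field_simp
    rw [hkdef, hK₁, h2e, div_div_eq_mul_div]
    field_simp
  linarith

/-- **Far out the Bernoulli function lies below its value at the centre**: under (3.8) and
`0 < γ < ½` there is `R > 0` with `ℋ(y) < ℋ(c)` for `|y − c| ≥ R`
(`ℋ(y) ≤ ½γ(2γ−1)|y−c|² + γ|y−c||U| + ½|U|² + P(c) + k`, `|U| = o(|y−c|)`, `ℋ(c) = P(c)`).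
[cite: ConstantinIgnatovaVicol2026Putative, §3.4.3 (3.30) with §3.1.3 (3.8)] -/
theorem selfSimilarBernoulli_lt_center_of_far (h : IsSelfSimilarEulerProfile γ c U P)
    (hγ : 0 < γ) (hγ2 : γ < 1 / 2) {C : ℝ} (hfar : HasSelfSimilarFarFieldWith γ c C U) :
    ∃ R : ℝ, 0 < R ∧ ∀ y, R ≤ ‖y - c‖ →
      selfSimilarBernoulli γ c U P y < selfSimilarBernoulli γ c U P c := by
  have hC0 : 0 ≤ C := hfar.nonneg
  set k : ℝ := C * (1 + C) * (γ / (1 - 2 * γ)) with hkdef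
  set a : ℝ := γ * (1 - 2 * γ) / 4 with hadef
  have ha : 0 < a := by
    have : 0 < 1 - 2 * γ := by linarith
    rw [hadef]; exact div_pos (mul_pos hγ this) (by norm_num)
  -- (i) the decay factor eventually small: `(γC + C²/2) δ(t) ≤ a`
  have hev1 : ∀ᶠ t : ℝ in atTop, (γ * C + C ^ 2 / 2) * (1 + t ^ 2) ^ (-(1 / (2 * γ))) ≤ a :=
    (HasSelfSimilarFarFieldWith.tendsto_decayFactor hγ (γ * C + C ^ 2 / 2)) (Iic_mem_nhds ha)
  -- (ii) `a t² > k` eventually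
  have hev2 : ∀ᶠ t : ℝ in atTop, k < a * t ^ 2 :=
    ((tendsto_pow_atTop two_ne_zero).const_mul_atTop ha).eventually_gt_atTop k
  obtain ⟨R₀, hR₀⟩ := Filter.eventually_atTop.1 (hev1.and hev2)
  refine ⟨max R₀ 1, lt_max_of_lt_right one_pos, fun y hy => ?_⟩
  have hyR₀ : R₀ ≤ ‖y - c‖ := (le_max_left _ _).trans hy
  obtain ⟨h1, h2⟩ := hR₀ _ hyR₀
  set r : ℝ := ‖y - c‖ with hr
  set δ : ℝ := (1 + r ^ 2) ^ (-(1 / (2 * γ))) with hδ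
  have hδ0 : 0 ≤ δ := Real.rpow_nonneg (by positivity) _
  have hδ1 : δ ≤ 1 := by
    rw [hδ]
    exact Real.rpow_le_one_of_one_le_of_nonpos (by nlinarith) (by
      have : 0 < 1 / (2 * γ) := by positivity
      linarith)
  -- the bounds at `y`
  have hU : ‖U y‖ ≤ C * r * δ := (hfar y).1
  have hP : P y ≤ P c + k := h.pressure_le_of_hasSelfSimilarFarFieldWith hγ hγ2 hfar y
  have hUc : U c = 0 := hfar.apply_center
  -- `ℋ(c) = P(c)` and `ℋ(y) = ½|γ(y−c) + U|² + P + ½γ(γ−1) r²`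
  have hHc : selfSimilarBernoulli γ c U P c = P c := by
    simp [selfSimilarBernoulli_apply, hUc]
  rw [hHc, selfSimilarBernoulli_apply]
  -- `½|γ(y−c)+U|² ≤ ½(γ r + |U|)²`
  have hV : ‖γ • (y - c) + U y‖ ≤ γ * r + ‖U y‖ := by
    calc ‖γ • (y - c) + U y‖ ≤ ‖γ • (y - c)‖ + ‖U y‖ := norm_add_le _ _
      _ = γ * r + ‖U y‖ := by rw [norm_smul, Real.norm_eq_abs, abs_of_pos hγ]
  have hV2 : ‖γ • (y - c) + U y‖ ^ 2 ≤ (γ * r + ‖U y‖) ^ 2 :=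
    pow_le_pow_left₀ (norm_nonneg _) hV 2
  -- `|U| ≤ C r δ` with `δ ≤ 1`
  have hu0 : 0 ≤ ‖U y‖ := norm_nonneg _
  have hr0 : 0 ≤ r := norm_nonneg _
  have hbd : (γ * r + ‖U y‖) ^ 2 ≤ γ ^ 2 * r ^ 2 + (2 * γ * C + C ^ 2) * r ^ 2 * δ := by
    have e1 : (γ * r + ‖U y‖) ^ 2 = γ ^ 2 * r ^ 2 + 2 * γ * r * ‖U y‖ + ‖U y‖ ^ 2 := by ring
    rw [e1]
    have h3 : 2 * γ * r * ‖U y‖ ≤ 2 * γ * r * (C * r * δ) :=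
      mul_le_mul_of_nonneg_left hU (by positivity)
    have h4 : ‖U y‖ ^ 2 ≤ (C * r * δ) ^ 2 := pow_le_pow_left₀ hu0 hU 2
    have h5 : (C * r * δ) ^ 2 ≤ C ^ 2 * r ^ 2 * δ := by
      have : δ ^ 2 ≤ δ := by nlinarith
      nlinarith [sq_nonneg (C * r)]
    nlinarith
  have hmain : (γ * C + C ^ 2 / 2) * δ ≤ a := h1
  nlinarith [sq_nonneg r, mul_nonneg (mul_nonneg (by positivity : (0:ℝ) ≤ 2 * γ * C + C ^ 2) (sq_nonneg r)) hδ0]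

/-- **The Bernoulli function attains its maximum on `ℝ³`, at a stagnation point** (`0 < γ < ½`,
(3.8)): the maximum exists since `ℋ < ℋ(c)` outside a ball, and a maximum is a critical point of
`ℋ`, hence (CIV (3.33), `V·∇ℋ = (2γ−1)|V|²`) a zero of `V`. [cite: ConstantinIgnatovaVicol2026Putative, §3.4.3 eq. (3.33)] -/
theorem exists_isMaxOn_selfSimilarBernoulli (h : IsSelfSimilarEulerProfile γ c U P)
    (hγ : 0 < γ) (hγ2 : γ < 1 / 2) {C : ℝ} (hfar : HasSelfSimilarFarFieldWith γ c C U) :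
    ∃ z ∈ selfSimilarNodalSet γ c U, IsMaxOn (selfSimilarBernoulli γ c U P) univ z := by
  obtain ⟨R, hR, hfarH⟩ := h.selfSimilarBernoulli_lt_center_of_far hγ hγ2 hfar
  have hHc : Continuous (selfSimilarBernoulli γ c U P) := h.contDiff_selfSimilarBernoulli.continuous
  have hev : ∀ᶠ y in cocompact (EuclideanSpace ℝ (Fin 3)),
      selfSimilarBernoulli γ c U P y ≤ selfSimilarBernoulli γ c U P c := by
    refine Filter.mem_cocompact.2 ⟨closedBall c R, isCompact_closedBall c R, fun y hy => ?_⟩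
    have hy' : R ≤ ‖y - c‖ := by
      rw [mem_compl_iff, mem_closedBall, dist_eq_norm, not_le] at hy
      exact hy.le
    exact (hfarH y hy').le
  obtain ⟨z, hz⟩ := hHc.exists_forall_ge' c hev
  have hmax : IsMaxOn (selfSimilarBernoulli γ c U P) univ z := fun y _ => hz y
  refine ⟨z, ?_, hmax⟩
  -- a maximum is a critical point, hence a stagnation point
  have hloc : IsLocalMax (selfSimilarBernoulli γ c U P) z := hmax.isLocalMax univ_mem
  have h0 : fderiv ℝ (selfSimilarBernoulli γ c U P) z = 0 := hloc.fderiv_eq_zero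
  have e := h.fderiv_selfSimilarBernoulli_transport z
  have e0 : fderiv ℝ (selfSimilarBernoulli γ c U P) z (selfSimilarTransport γ c U z) = 0 := by
    rw [h0]; rfl
  rw [e0] at e
  have h2 : 2 * γ - 1 ≠ 0 := by intro h1; linarith
  have : ‖selfSimilarTransport γ c U z‖ ^ 2 = 0 := by
    rcases mul_eq_zero.1 e.symm with h1 | h1
    · exact absurd h1 h2
    · exact h1
  exact norm_eq_zero.1 (pow_eq_zero_iff (n := 2) (by norm_num) |>.1 this)

/-- **The Bernoulli-top stagnation point is a good node.** For `0 < γ < ½` and a `C²` profile with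
the far-field bounds (3.8) there is a stagnation point `z` at which `ℋ` attains its global maximum;
it is non-vortical (`curl U z = 0`) and `DV(z) ≥ 0`, i.e. `⟪DU(z) w, w⟫ ≤ 2γ|w|²` for all `w`
(`SelfSimilarEulerBernoulliLocalMax`). [cite: ConstantinIgnatovaVicol2026Putative, §3.4.3–§3.5 (structure at the Bernoulli maximum; not in print)] -/
theorem exists_bernoulliTop_stagnation (h : IsSelfSimilarEulerProfile γ c U P)
    (hγ : 0 < γ) (hγ2 : γ < 1 / 2) {C : ℝ} (hfar : HasSelfSimilarFarFieldWith γ c C U) :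
    ∃ z ∈ selfSimilarNodalSet γ c U, IsMaxOn (selfSimilarBernoulli γ c U P) univ z ∧
      curl U z = 0 ∧ ∀ w : EuclideanSpace ℝ (Fin 3), ⟪fderiv ℝ U z w, w⟫ ≤ 2 * γ * ‖w‖ ^ 2 := by
  obtain ⟨z, hz, hmax⟩ := h.exists_isMaxOn_selfSimilarBernoulli hγ hγ2 hfar
  have hloc : IsLocalMax (selfSimilarBernoulli γ c U P) z := hmax.isLocalMax univ_mem
  have hγ' : γ ≠ 1 / 2 := by intro h0; linarith
  have hΩ : curl U z = 0 := by
    by_contra hne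
    exact h.not_isLocalMax_selfSimilarBernoulli_of_curl_ne_zero hγ' hz hne hloc
  exact ⟨z, hz, hmax, hΩ, fun w => h.inner_fderiv_le_of_isLocalMax_selfSimilarBernoulli hγ2 hz hloc w⟩

/-- **A nontrivial in-window profile has at least two stagnation points.** For `0 < γ < ½` and a
nontrivial `C²` profile with the far-field bounds (3.8): the Bernoulli-top stagnation point `z₁`
(good: `⟪DU(z₁) w, w⟫ ≤ 2γ|w|²`) and a stagnation point `z₂` carrying a stretching rate `≥ 1`
(`exists_stagnation_stretching_ge_one`) both exist and are distinct. [cite: ConstantinIgnatovaVicol2026Putative, §3.5 Thm. 3.8 / Thm. 3.10 (combined and sharpened; not in print)] -/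
theorem exists_two_stagnation_points (h : IsSelfSimilarEulerProfile γ c U P)
    (hγ : 0 < γ) (hγ2 : γ < 1 / 2) (hfar : HasSelfSimilarFarField γ c U) (hU : U ≠ 0) :
    ∃ z₁ ∈ selfSimilarNodalSet γ c U, ∃ z₂ ∈ selfSimilarNodalSet γ c U, z₁ ≠ z₂ ∧
      IsMaxOn (selfSimilarBernoulli γ c U P) univ z₁ ∧
      (∀ w : EuclideanSpace ℝ (Fin 3), ⟪fderiv ℝ U z₁ w, w⟫ ≤ 2 * γ * ‖w‖ ^ 2) ∧
      ∃ w : EuclideanSpace ℝ (Fin 3), w ≠ 0 ∧ ‖w‖ ^ 2 ≤ ⟪fderiv ℝ U z₂ w, w⟫ := by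
  obtain ⟨C, hC⟩ := hfar
  obtain ⟨z₁, hz₁, hmax, -, hgood⟩ := h.exists_bernoulliTop_stagnation hγ hγ2 hC
  obtain ⟨z₂, hz₂, w, hw, hbad⟩ := h.exists_stagnation_stretching_ge_one hγ hγ2 ⟨C, hC⟩ hU
  refine ⟨z₁, hz₁, z₂, hz₂, ?_, hmax, hgood, w, hw, hbad⟩
  rintro rfl
  have h1 := hgood w
  have hwpos : 0 < ‖w‖ ^ 2 := pow_pos (norm_pos_iff.2 hw) 2
  have h12 : 0 < 1 - 2 * γ := by linarith
  nlinarith [mul_pos h12 hwpos]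

/-- **A profile whose stagnation set is a single point (or empty) is trivial** (`0 < γ < ½`,
(3.8)). In CIV's normalisation the centre is always a stagnation point ((3.5), (3.8):
`HasSelfSimilarFarField.apply_center`), so: an in-window profile whose ONLY stagnation point is
the centre vanishes identically. [cite: ConstantinIgnatovaVicol2026Putative, §3.5 (sharpened; not in print)] -/
theorem eq_zero_of_selfSimilarNodalSet_subsingleton (h : IsSelfSimilarEulerProfile γ c U P)
    (hγ : 0 < γ) (hγ2 : γ < 1 / 2) (hfar : HasSelfSimilarFarField γ c U)
    (hN : (selfSimilarNodalSet γ c U).Subsingleton) : U = 0 := by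
  by_contra hU
  obtain ⟨z₁, hz₁, z₂, hz₂, hne, -⟩ := h.exists_two_stagnation_points hγ hγ2 hfar hU
  exact hne (hN hz₁ hz₂)

end IsSelfSimilarEulerProfile

end Literature.Analysis.FluidPDE

end
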